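import Mathlib
import Summits.Ventures.PercRepro2.A3PendantOFibres
import Summits.Ventures.PercRepro2.CrossWeightedBHK
import Summits.Ventures.PercRepro2.A3BetweenDZero

/-!
# (MEANS-a₃) holds when `a₃` is a leaf at `b` — the second kernel class theorem of `A3Between`
(blind cell PercRepro2, night-1 g30; proofs/NIGHT1-G30.md §6, the paper theorem of NIGHT1-G29.md §5.3 (b))

Let `a₃` be a leaf attached to `b` by the edge `f` of weight `q`.  The fibre lemmas of
A3PendantOFibres.lean apply with the attachment mark `b` (they are generic in the attachment vertex):
the non-null fibres are `{a₃}` and the sets containing `a₃` and `b`, on which `Ssig_b = s3 · m_W`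
(A3FibreMark), so the first ratio sum of `btw` collapses to the `{a₃}`-term plus `∑_W s3 W · SF W`
(`sum_Ssig_SF_div_leaf_b`) and the `A`-ratio sum to the `{a₃}`-term (`sum_Su_Su_div_leaf_b`); the
world sums are `E_Q[σ₃ σ_o]`, `P(Q) − D`, `m_o − D_o` (`sum_s3_SF`).  With the `a₃`-moments as
`b`-marked masses (`EQ3o_leaf_b`, `Do_leaf_b`, `PDb_leaf_b`, PendantO's generic `prob_*_o`) the
between-term is

  **`btw · D · P(Q) = q · [2 (1 − q) · CW + q · TM]`**   (`btw_pendant_b_mul`),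

where `CW ≥ 0` is the cleared (FM-b) `CrossWeighted.crossWeighted_nonneg` and `TM ≥ 0` the cleared
(M1) `CrossWeighted.twoMeans_nonneg` of CrossWeightedBHK.lean — the «affine in the mixing parameter»
argument of NIGHT1-G29.md §5.3 (b) in cleared form (verified exactly on 120 pendant instances before
the proof).  Hence **`A3Between_pendant_b`** (the case `D = 0` by p5's dichotomy `RootEdge.A3Between_of_PD_null`,
A3BetweenDZero.lean).  Standard axioms.
-/

namespace Summit.Ventures.PercRepro2

open UnionCluster CovForm PendantRoot PendantO

namespace CovForm

namespace A3Fibre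

section LeafB

variable {V : Type*} {E : Type*} [Fintype V] [DecidableEq V] [Fintype E] [DecidableEq E]
  {R : Type*} [Field R] [LinearOrder R] [IsStrictOrderedRing R]
  {ends : E → Sym2 V} {f : E} {a₃ b : V}

/-- **The first ratio sum of `btw` at a leaf `a₃` at `b`**: the fibre `{a₃}` keeps its ratio; on every
other non-null fibre `Ssig_b = s3 · m_W` cancels the denominator. -/
lemma sum_Ssig_SF_div_leaf_b {p : E → R} (hp : IsProbVec p) (hf : ends f = s(a₃, b))
    (hleaf : ∀ e, a₃ ∈ ends e → e = f) (h3b : a₃ ≠ b) {a₁ a₂ : V} (h31 : a₃ ≠ a₁) (h32 : a₃ ≠ a₂)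
    (o : V) :
    ∑ W : Finset V, Ssig p ends a₁ a₂ a₃ b W * SF p ends o a₁ a₂ a₃ W / mW p ends a₁ a₂ a₃ W =
      Ssig p ends a₁ a₂ a₃ b {a₃} * SF p ends o a₁ a₂ a₃ {a₃} / mW p ends a₁ a₂ a₃ {a₃} +
        ∑ W : Finset V, s3 a₁ a₂ W * SF p ends o a₁ a₂ a₃ W := by
  have key : ∀ W : Finset V,
      Ssig p ends a₁ a₂ a₃ b W * SF p ends o a₁ a₂ a₃ W / mW p ends a₁ a₂ a₃ W =
        s3 a₁ a₂ W * SF p ends o a₁ a₂ a₃ W +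
          (if W = {a₃} then
            Ssig p ends a₁ a₂ a₃ b {a₃} * SF p ends o a₁ a₂ a₃ {a₃} / mW p ends a₁ a₂ a₃ {a₃} -
              s3 a₁ a₂ {a₃} * SF p ends o a₁ a₂ a₃ {a₃}
          else 0) := by
    intro W
    by_cases hW : W = {a₃}
    · subst hW
      simp only [if_true]
      ring
    · rw [if_neg hW, add_zero]
      by_cases hb : b ∈ W
      · rw [Ssig_eq_of_mem p ends a₁ a₂ a₃ b W hb]
        by_cases hm : mW p ends a₁ a₂ a₃ W = 0
        · rw [hm, SF_eq_zero_of_mW_eq_zero hp ends o a₁ a₂ a₃ W hm]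
          ring
        · field_simp
      · have hm := mW_eq_zero_of_leaf p hf hleaf h3b a₁ a₂ hW hb
        rw [Ssig_eq_zero_of_mW_eq_zero hp ends a₁ a₂ a₃ b W hm,
          SF_eq_zero_of_mW_eq_zero hp ends o a₁ a₂ a₃ W hm]
        ring
  rw [Finset.sum_congr rfl (fun W _ => key W)]
  rw [Finset.sum_add_distrib, Finset.sum_ite_eq', if_pos (Finset.mem_univ _),
    s3_singleton (R := R) a₁ a₂ h31 h32]
  ring

/-- **The `A`-ratio sum of `btw` at a leaf `a₃` at `b`** collapses to the fibre `{a₃}`. -/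
lemma sum_Su_Su_div_leaf_b {p : E → R} (hp : IsProbVec p) (hf : ends f = s(a₃, b))
    (hleaf : ∀ e, a₃ ∈ ends e → e = f) (h3b : a₃ ≠ b) {a₁ a₂ : V} (h31 : a₃ ≠ a₁) (h32 : a₃ ≠ a₂)
    (o : V) :
    ∑ W ∈ fibresA a₁ a₂, Su p ends a₁ a₂ a₃ b W * Su p ends a₁ a₂ a₃ o W / mW p ends a₁ a₂ a₃ W =
      Su p ends a₁ a₂ a₃ b {a₃} * Su p ends a₁ a₂ a₃ o {a₃} / mW p ends a₁ a₂ a₃ {a₃} := by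
  apply Finset.sum_eq_single
  · intro W hWA hW
    rw [fibresA, Finset.mem_filter] at hWA
    by_cases hb : b ∈ W
    · rw [Su_eq_of_mem p ends a₁ a₂ a₃ b W hb]
      have hs : (s3 a₁ a₂ W : R) = 0 := by
        unfold s3
        simp [hWA.2.1, hWA.2.2]
      rw [hs]
      ring
    · have hm := mW_eq_zero_of_leaf p hf hleaf h3b a₁ a₂ hW hb
      rw [hm, Su_eq_zero_of_mW_eq_zero hp ends a₁ a₂ a₃ b W hm]
      ring
  · intro h
    exfalso
    apply h
    rw [fibresA, Finset.mem_filter]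
    exact ⟨Finset.mem_univ _, by simp [Finset.mem_singleton, Ne.symm h31, Ne.symm h32]⟩

omit [Fintype V] [LinearOrder R] [IsStrictOrderedRing R] in
/-- `(s3 W)² = 1 − 1_{A}(W)`. -/
lemma s3_sq (a₁ a₂ : V) (W : Finset V) :
    (s3 a₁ a₂ W : R) ^ 2 = 1 - (if a₁ ∉ W ∧ a₂ ∉ W then 1 else 0) := by
  unfold s3
  by_cases h₁ : a₁ ∈ W <;> by_cases h₂ : a₂ ∈ W <;> simp [h₁, h₂]

omit [LinearOrder R] [IsStrictOrderedRing R] in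
/-- `∑_W Su_o W = P(Q, o ∈ C₁) + P(Q, o ∈ C₂)`. -/
lemma sum_Su (p : E → R) (ends : E → Sym2 V) (a₁ a₂ a₃ o : V) :
    ∑ W : Finset V, Su p ends a₁ a₂ a₃ o W =
      prob p (avoidAll ends a₂ {a₁} ∩ connEvent ends a₁ o) +
        prob p (avoidAll ends a₂ {a₁} ∩ connEvent ends a₂ o) := by
  unfold Su
  rw [Finset.sum_add_distrib, sum_prob_fibre_inter, sum_prob_fibre_inter]

/-- **The world sum** `∑_W s3 W · SF W = E_Q[σ₃ σ_o] + γ (P(Q) − D) − (m_o − D_o)`. -/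
lemma sum_s3_SF (p : E → R) (ends : E → Sym2 V) (o a₁ a₂ a₃ : V) :
    ∑ W : Finset V, s3 a₁ a₂ W * SF p ends o a₁ a₂ a₃ W =
      EQb3 p ends a₁ a₂ a₃ o +
        gamma p ends o a₁ a₂ a₃ * (prob p (avoidAll ends a₂ {a₁}) - prob p (PDEvent ends a₁ a₂ a₃)) -
        (prob p (avoidAll ends a₂ {a₁} ∩ connEvent ends a₁ o) +
          prob p (avoidAll ends a₂ {a₁} ∩ connEvent ends a₂ o) - Do p ends o a₁ a₂ a₃) := by
  have e : ∀ W : Finset V, s3 a₁ a₂ W * SF p ends o a₁ a₂ a₃ W =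
      s3 a₁ a₂ W * Ssig p ends a₁ a₂ a₃ o W +
        gamma p ends o a₁ a₂ a₃ * (mW p ends a₁ a₂ a₃ W - (if a₁ ∉ W ∧ a₂ ∉ W then mW p ends a₁ a₂ a₃ W else 0)) -
        (Su p ends a₁ a₂ a₃ o W - (if a₁ ∉ W ∧ a₂ ∉ W then Su p ends a₁ a₂ a₃ o W else 0)) := by
    intro W
    unfold SF
    have h2 := s3_sq (R := R) a₁ a₂ W
    split_ifs at h2 ⊢ with hA <;> linear_combination (gamma p ends o a₁ a₂ a₃ * mW p ends a₁ a₂ a₃ W - Su p ends a₁ a₂ a₃ o W) * h2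
  rw [Finset.sum_congr rfl (fun W _ => e W), Finset.sum_sub_distrib, Finset.sum_add_distrib,
    ← Finset.mul_sum, Finset.sum_sub_distrib, Finset.sum_sub_distrib, ← EQb3_eq, sum_mW,
    ← prob_PD_eq, sum_Su, ← Do_eq]

end LeafB


section LeafBMasses

variable {V : Type*} {E : Type*} [Fintype E] [DecidableEq E] {R : Type*} [Field R]
  {ends : E → Sym2 V} {f : E} {a₃ b : V} (p : E → R)

/-- `E_Q[σ₃ U_o] = q · (P(Q, bL, oL) + P(Q, bL, oH) − P(Q, bH, oL) − P(Q, bH, oH))` at a leaf at `b`. -/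
lemma EQ3o_leaf_b (hf : ends f = s(a₃, b)) (hleaf : ∀ e, a₃ ∈ ends e → e = f) (h3b : a₃ ≠ b)
    {a₁ a₂ : V} (h31 : a₃ ≠ a₁) (h32 : a₃ ≠ a₂) {o : V} (ho : o ≠ a₃) :
    EQ3o p ends o a₁ a₂ a₃ =
      p f * (prob p (avoidAll ends a₂ {a₁} ∩ (connEvent ends a₁ b ∩ connEvent ends a₁ o)) +
        prob p (avoidAll ends a₂ {a₁} ∩ (connEvent ends a₁ b ∩ connEvent ends a₂ o)) -
        prob p (avoidAll ends a₂ {a₁} ∩ (connEvent ends a₂ b ∩ connEvent ends a₁ o)) -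
        prob p (avoidAll ends a₂ {a₁} ∩ (connEvent ends a₂ b ∩ connEvent ends a₂ o))) := by
  have c₁o := free_connEvent hf hleaf h3b (Ne.symm h31) ho
  have c₂o := free_connEvent hf hleaf h3b (Ne.symm h32) ho
  unfold EQ3o
  rw [prob_T'_inter_o p hf hleaf h3b h31 h32 c₁o, prob_T'_inter_o p hf hleaf h3b h31 h32 c₂o,
    prob_T_inter_o p hf hleaf h3b h31 h32 c₁o, prob_T_inter_o p hf hleaf h3b h31 h32 c₂o]
  ring

/-- `D_o = m_o − q · P(Q, b ∈ U, o ∈ U)` at a leaf at `b`. -/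
lemma Do_leaf_b (hf : ends f = s(a₃, b)) (hleaf : ∀ e, a₃ ∈ ends e → e = f) (h3b : a₃ ≠ b)
    {a₁ a₂ : V} (h31 : a₃ ≠ a₁) (h32 : a₃ ≠ a₂) {o : V} (ho : o ≠ a₃) :
    Do p ends o a₁ a₂ a₃ =
      prob p (avoidAll ends a₂ {a₁} ∩ connEvent ends a₁ o) +
        prob p (avoidAll ends a₂ {a₁} ∩ connEvent ends a₂ o) -
        p f * (prob p (avoidAll ends a₂ {a₁} ∩ (connEvent ends a₁ b ∩ connEvent ends a₁ o)) +
          prob p (avoidAll ends a₂ {a₁} ∩ (connEvent ends a₂ b ∩ connEvent ends a₁ o)) +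
          prob p (avoidAll ends a₂ {a₁} ∩ (connEvent ends a₁ b ∩ connEvent ends a₂ o)) +
          prob p (avoidAll ends a₂ {a₁} ∩ (connEvent ends a₂ b ∩ connEvent ends a₂ o))) := by
  have c₁o := free_connEvent hf hleaf h3b (Ne.symm h31) ho
  have c₂o := free_connEvent hf hleaf h3b (Ne.symm h32) ho
  unfold Do
  rw [prob_PD_inter_o p hf hleaf h3b h31 h32 c₁o, prob_PD_inter_o p hf hleaf h3b h31 h32 c₂o]
  ring

/-- `P(PD, b ∈ U) = (1 − q) · m_b` at a leaf at `b`. -/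
lemma PDb_leaf_b (hf : ends f = s(a₃, b)) (hleaf : ∀ e, a₃ ∈ ends e → e = f) (h3b : a₃ ≠ b)
    {a₁ a₂ : V} (h31 : a₃ ≠ a₁) (h32 : a₃ ≠ a₂) :
    PDb p ends a₁ a₂ a₃ b =
      (prob p (avoidAll ends a₂ {a₁} ∩ connEvent ends a₁ b) +
        prob p (avoidAll ends a₂ {a₁} ∩ connEvent ends a₂ b)) * (1 - p f) := by
  have c₁b := free_connEvent hf hleaf h3b (Ne.symm h31) (Ne.symm h3b)
  have c₂b := free_connEvent hf hleaf h3b (Ne.symm h32) (Ne.symm h3b)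
  unfold PDb
  rw [prob_PD_inter_o p hf hleaf h3b h31 h32 c₁b, prob_PD_inter_o p hf hleaf h3b h31 h32 c₂b,
    Set.inter_self, Set.inter_self, Q_inter_both_eq_empty₂ ends a₁ a₂ b,
    Q_inter_both_eq_empty₂' ends a₁ a₂ b, prob_empty]
  ring

end LeafBMasses


section AssemblyB

variable {V : Type*} {E : Type*} [Fintype V] [DecidableEq V] [Fintype E] [DecidableEq E]
  {R : Type*} [Field R] [LinearOrder R] [IsStrictOrderedRing R]
  {ends : E → Sym2 V} {f : E} {a₃ b : V}

/-- **The between-term at a leaf `a₃` at `b`, through the `b`-marked masses.** -/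
lemma btw_leaf_b_expanded {p : E → R} (hp : IsProbVec p) (hf : ends f = s(a₃, b))
    (hleaf : ∀ e, a₃ ∈ ends e → e = f) (h3b : a₃ ≠ b) {a₁ a₂ o : V} (h31 : a₃ ≠ a₁) (h32 : a₃ ≠ a₂)
    (ho : o ≠ a₃) :
    btw p ends o a₁ a₂ a₃ b =
      ((prob p (avoidAll ends a₂ {a₁} ∩ connEvent ends a₁ b) -
            prob p (avoidAll ends a₂ {a₁} ∩ connEvent ends a₂ b)) * (1 - p f)) *
          ((prob p (avoidAll ends a₂ {a₁} ∩ connEvent ends a₁ o) -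
            prob p (avoidAll ends a₂ {a₁} ∩ connEvent ends a₂ o)) * (1 - p f)) /
          (prob p (avoidAll ends a₂ {a₁}) * (1 - p f)) +
        (p f * EQbo p ends b a₁ a₂ o +
          Do p ends o a₁ a₂ a₃ / prob p (PDEvent ends a₁ a₂ a₃) *
            (prob p (avoidAll ends a₂ {a₁}) - prob p (PDEvent ends a₁ a₂ a₃)) -
          (prob p (avoidAll ends a₂ {a₁} ∩ connEvent ends a₁ o) +
            prob p (avoidAll ends a₂ {a₁} ∩ connEvent ends a₂ o) - Do p ends o a₁ a₂ a₃)) -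
        EQo p ends b a₁ a₂ *
          (EQo p ends o a₁ a₂ +
            Do p ends o a₁ a₂ a₃ / prob p (PDEvent ends a₁ a₂ a₃) * (p f * EQo p ends b a₁ a₂) -
            EQ3o p ends o a₁ a₂ a₃) / prob p (avoidAll ends a₂ {a₁}) -
        ((prob p (avoidAll ends a₂ {a₁} ∩ connEvent ends a₁ b) +
            prob p (avoidAll ends a₂ {a₁} ∩ connEvent ends a₂ b)) * (1 - p f)) *
          ((prob p (avoidAll ends a₂ {a₁} ∩ connEvent ends a₁ o) +
            prob p (avoidAll ends a₂ {a₁} ∩ connEvent ends a₂ o)) * (1 - p f)) /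
          (prob p (avoidAll ends a₂ {a₁}) * (1 - p f)) +
        PDb p ends a₁ a₂ a₃ b * Do p ends o a₁ a₂ a₃ / prob p (PDEvent ends a₁ a₂ a₃) := by
  unfold btw
  rw [sum_Ssig_SF_div_leaf_b hp hf hleaf h3b h31 h32 o, sum_Su_Su_div_leaf_b hp hf hleaf h3b h31 h32 o,
    sum_s3_SF, ← EQo_eq p ends b a₁ a₂ a₃, sum_SF, ← EQo_eq, ← EQ3_eq, ← EQ3o_eq,
    fibresA, Finset.sum_filter, Finset.sum_filter, ← PDb_eq, ← Do_eq,
    SF_singleton_leaf p h31 h32, mW_singleton_leaf p hf hleaf h3b h31 h32,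
    Ssig_singleton_leaf p hf hleaf h3b h31 h32 (Ne.symm h3b), Ssig_singleton_leaf p hf hleaf h3b h31 h32 ho,
    Su_singleton_leaf p hf hleaf h3b h31 h32 (Ne.symm h3b), Su_singleton_leaf p hf hleaf h3b h31 h32 ho,
    EQb3_leaf p hf hleaf h3b h31 h32 ho, EQ3_leaf p hf hleaf h3b h31 h32]
  unfold gamma
  ring

/-- **The closed form at a leaf `a₃` at `b`**: `btw = q · (2 (1 − q) · CW + q · TM) / (D · P(Q))`
with `CW`, `TM` the cleared (FM-b) and (M1) forms of CrossWeightedBHK.lean, when `P(Q) ≠ 0`, `D ≠ 0`. -/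
theorem btw_pendant_b {p : E → R} (hp : IsProbVec p) (hf : ends f = s(a₃, b))
    (hleaf : ∀ e, a₃ ∈ ends e → e = f) (h3b : a₃ ≠ b) {a₁ a₂ o : V} (h31 : a₃ ≠ a₁) (h32 : a₃ ≠ a₂)
    (ho : o ≠ a₃) (hQ : prob p (avoidAll ends a₂ {a₁}) ≠ 0)
    (hD : prob p (PDEvent ends a₁ a₂ a₃) ≠ 0) :
    btw p ends o a₁ a₂ a₃ b =
      p f * (2 * (1 - p f) * ((prob p (avoidAll ends a₂ {a₁}) + prob p (avoidAll ends a₂ {a₁} ∩ connEvent ends a₂ b)) *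
          (prob p (avoidAll ends a₂ {a₁} ∩ connEvent ends a₁ b) *
              prob p (avoidAll ends a₂ {a₁} ∩ connEvent ends a₂ o) -
            prob p (avoidAll ends a₂ {a₁}) *
              prob p (avoidAll ends a₂ {a₁} ∩ connEvent ends a₁ b ∩ connEvent ends a₂ o)) +
        (prob p (avoidAll ends a₂ {a₁}) + prob p (avoidAll ends a₂ {a₁} ∩ connEvent ends a₁ b)) *
          (prob p (avoidAll ends a₂ {a₁} ∩ connEvent ends a₂ b) *
              prob p (avoidAll ends a₂ {a₁} ∩ connEvent ends a₁ o) -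
            prob p (avoidAll ends a₂ {a₁}) *
              prob p (avoidAll ends a₂ {a₁} ∩ connEvent ends a₂ b ∩ connEvent ends a₁ o)) -
        prob p (avoidAll ends a₂ {a₁} ∩ connEvent ends a₂ b) *
          (prob p (avoidAll ends a₂ {a₁}) *
              prob p (avoidAll ends a₂ {a₁} ∩ connEvent ends a₁ b ∩ connEvent ends a₁ o) -
            prob p (avoidAll ends a₂ {a₁} ∩ connEvent ends a₁ b) *
              prob p (avoidAll ends a₂ {a₁} ∩ connEvent ends a₁ o)) -
        prob p (avoidAll ends a₂ {a₁} ∩ connEvent ends a₁ b) *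
          (prob p (avoidAll ends a₂ {a₁}) *
              prob p (avoidAll ends a₂ {a₁} ∩ connEvent ends a₂ b ∩ connEvent ends a₂ o) -
            prob p (avoidAll ends a₂ {a₁} ∩ connEvent ends a₂ b) *
              prob p (avoidAll ends a₂ {a₁} ∩ connEvent ends a₂ o))) + p f * (2 * (prob p (avoidAll ends a₂ {a₁}) - prob p (avoidAll ends a₂ {a₁} ∩ connEvent ends a₁ b) +
            prob p (avoidAll ends a₂ {a₁} ∩ connEvent ends a₂ b)) *
          (prob p (avoidAll ends a₂ {a₁} ∩ connEvent ends a₁ b) *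
              prob p (avoidAll ends a₂ {a₁} ∩ ((connEvent ends a₁ b)ᶜ ∩ (connEvent ends a₂ b)ᶜ) ∩
                connEvent ends a₂ o) -
            prob p (avoidAll ends a₂ {a₁} ∩ ((connEvent ends a₁ b)ᶜ ∩ (connEvent ends a₂ b)ᶜ)) *
              prob p (avoidAll ends a₂ {a₁} ∩ connEvent ends a₁ b ∩ connEvent ends a₂ o)) +
        2 * (prob p (avoidAll ends a₂ {a₁}) + prob p (avoidAll ends a₂ {a₁} ∩ connEvent ends a₁ b) -
            prob p (avoidAll ends a₂ {a₁} ∩ connEvent ends a₂ b)) *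
          (prob p (avoidAll ends a₂ {a₁} ∩ connEvent ends a₂ b) *
              prob p (avoidAll ends a₂ {a₁} ∩ ((connEvent ends a₁ b)ᶜ ∩ (connEvent ends a₂ b)ᶜ) ∩
                connEvent ends a₁ o) -
            prob p (avoidAll ends a₂ {a₁} ∩ ((connEvent ends a₁ b)ᶜ ∩ (connEvent ends a₂ b)ᶜ)) *
              prob p (avoidAll ends a₂ {a₁} ∩ connEvent ends a₂ b ∩ connEvent ends a₁ o)))) /
        (prob p (PDEvent ends a₁ a₂ a₃) * prob p (avoidAll ends a₂ {a₁})) := by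
  rw [btw_leaf_b_expanded hp hf hleaf h3b h31 h32 ho, Do_leaf_b p hf hleaf h3b h31 h32 ho,
    PDb_leaf_b p hf hleaf h3b h31 h32, EQ3o_leaf_b p hf hleaf h3b h31 h32 ho]
  rw [prob_PD_o p hf hleaf h3b h31 h32] at hD ⊢
  have hN0 := CrossWeighted.status_split p ends a₁ a₂ b Set.univ
  have hNH := CrossWeighted.status_split p ends a₁ a₂ b (connEvent ends a₂ o)
  have hNL := CrossWeighted.status_split p ends a₁ a₂ b (connEvent ends a₁ o)
  simp only [Set.inter_univ] at hN0
  have eN0 : prob p (avoidAll ends a₂ {a₁} ∩ ((connEvent ends a₁ b)ᶜ ∩ (connEvent ends a₂ b)ᶜ)) =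
      prob p (avoidAll ends a₂ {a₁}) - prob p (avoidAll ends a₂ {a₁} ∩ connEvent ends a₁ b) -
        prob p (avoidAll ends a₂ {a₁} ∩ connEvent ends a₂ b) := by linarith
  have eNH : prob p (avoidAll ends a₂ {a₁} ∩ ((connEvent ends a₁ b)ᶜ ∩ (connEvent ends a₂ b)ᶜ) ∩
      connEvent ends a₂ o) =
      prob p (avoidAll ends a₂ {a₁} ∩ connEvent ends a₂ o) -
        prob p (avoidAll ends a₂ {a₁} ∩ connEvent ends a₁ b ∩ connEvent ends a₂ o) -
        prob p (avoidAll ends a₂ {a₁} ∩ connEvent ends a₂ b ∩ connEvent ends a₂ o) := by linarith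
  have eNL : prob p (avoidAll ends a₂ {a₁} ∩ ((connEvent ends a₁ b)ᶜ ∩ (connEvent ends a₂ b)ᶜ) ∩
      connEvent ends a₁ o) =
      prob p (avoidAll ends a₂ {a₁} ∩ connEvent ends a₁ o) -
        prob p (avoidAll ends a₂ {a₁} ∩ connEvent ends a₁ b ∩ connEvent ends a₁ o) -
        prob p (avoidAll ends a₂ {a₁} ∩ connEvent ends a₂ b ∩ connEvent ends a₁ o) := by linarith
  rw [eN0, eNH, eNL]
  unfold EQbo EQo
  simp only [Set.inter_assoc]
  set D := prob p (avoidAll ends a₂ {a₁}) - p f * prob p (avoidAll ends a₂ {a₁} ∩ connEvent ends a₁ b) -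
    p f * prob p (avoidAll ends a₂ {a₁} ∩ connEvent ends a₂ b) with hDdef
  by_cases h1 : (1 : R) - p f = 0
  · have hpf : p f = 1 := by linarith
    rw [h1]
    simp only [mul_zero, zero_mul, zero_div, add_zero, sub_zero, zero_add]
    field_simp
    rw [hDdef, hpf]
    ring
  · field_simp
    rw [hDdef]
    ring

end AssemblyB


section ClassB

variable {V : Type*} {E : Type*} [Fintype V] [DecidableEq V] [Fintype E] [DecidableEq E]
  {R : Type*} [Field R] [LinearOrder R] [IsStrictOrderedRing R]
  {ends : E → Sym2 V} {f : E} {a₃ b : V}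

/-- **(MEANS-a₃) at a leaf `a₃` attached to `b`, at every weight of the leaf edge** (the case
`D = 0` by p5's dichotomy `RootEdge.A3Between_of_PD_null`). -/
theorem A3Between_pendant_b {p : E → R} (hp : IsProbVec p) (hf : ends f = s(a₃, b))
    (hleaf : ∀ e, a₃ ∈ ends e → e = f) (h3b : a₃ ≠ b) {a₁ a₂ o : V} (h31 : a₃ ≠ a₁) (h32 : a₃ ≠ a₂)
    (ho : o ≠ a₃) : A3Between p ends o a₁ a₂ a₃ b := by
  by_cases hD : prob p (PDEvent ends a₁ a₂ a₃) = 0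
  · exact RootEdge.A3Between_of_PD_null p hp o b hD
  have hQ : prob p (avoidAll ends a₂ {a₁}) ≠ 0 := by
    intro hQ
    apply hD
    have h1 := prob_PD_le_Q hp ends a₁ a₂ a₃
    have h2 := prob_nonneg hp (PDEvent ends a₁ a₂ a₃)
    rw [hQ] at h1
    linarith
  unfold A3Between
  rw [btw_pendant_b hp hf hleaf h3b h31 h32 ho hQ hD]
  have hCW := CrossWeighted.crossWeighted_nonneg p hp ends o a₁ a₂ b
  have hTM := CrossWeighted.twoMeans_nonneg p hp ends o a₁ a₂ b
  have hq0 := hp.nonneg f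
  have hq1 : 0 ≤ 1 - p f := sub_nonneg.2 (hp.le_one f)
  have hDn := prob_nonneg hp (PDEvent ends a₁ a₂ a₃)
  have hQn := prob_nonneg hp (avoidAll ends a₂ {a₁})
  apply div_nonneg
  · apply mul_nonneg hq0
    apply add_nonneg
    · exact mul_nonneg (mul_nonneg (by norm_num) hq1) hCW
    · exact mul_nonneg hq0 hTM
  · exact mul_nonneg hDn hQn

end ClassB

end A3Fibre

end CovForm

end Summit.Ventures.PercRepro2
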